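import Summits.QuantumFields.YangMills.Theses.LangevinControlUV
import Summits.QuantumFields.YangMills.Theorems.LangevinControlUVLatticeGapInUVUnitsSlabToDecay
import Summits.QuantumFields.YangMills.Theorems.LangevinControlUVLatticeGapInUVUnitsDecayToClustering
import Summits.QuantumFields.YangMills.Theorems.LangevinControlUVLatticeGapInUVUnitsReduction

/-!
# Crux `LatticeGapInUVUnits`, line `femto-slab-nondegeneracy`: the checked reduction to the femto-slab certificate

Support file for item stmt-QuantumFields-9366 (route `LangevinControlUV` of `YangMills`).  With the two provable stubs
of the line LANDED — S2 `stub_slabToDecay` (p96985: slab inequality ⇒ geometric decay of conditional expectations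
along the nested exteriors of a slab) and S3 `stub_decayToClustering` (p97393: decay ⇒ exponential clustering of
`latticeConnectedCorr` in the crux's currency) — the line's composition becomes two kernel-checked implications, stated
here with every hypothesis WRITTEN OUT in the route's own vocabulary (no definition is introduced):

* `cruxRepaired_of_femtoSlab` : the femto-slab certificate S1 ALONE (for compact simple `G`, faithful `r` and
  CONTINUOUS unit maps `a` carrying the femto two-point package: one two-sided slab inequality
  `Var F ≤ K ∫ (F − μ[F | links ≥ D(β) layers away])²` on the torus `(2S+1)⁴`, `S ≥ S₁ β`, at margin
  `D(β) = ⌈Θ/a β⌉`, constant `K` uniform in `β`, volume and slab) implies the REPAIRED crux C′ of the standing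
  disprover (`Cruxes/LatticeGapInUVUnits/Disproof.lean` §9 `CruxRepaired`: the crux restricted to continuous unit maps);
* `latticeGapInUVUnits_of_rulerReduction_of_femtoSlab` : together with the typed-`∀a` socket S0 (`RulerReduction`:
  every unit map with the package is eventually dominated by a continuous one with the package — where the known
  misstatement of the crux is parked; false modulo `FixedTorusTwoSidedSU`, tree
  `Negative/RulerReductionFalseOfFixedTorusTwoSidedSU`) it implies the crux `LatticeGapInUVUnits` BY NAME.

The proofs are the line's pipeline (`reduction_concl_of_slab`): S2 turns the slab inequality at margin
`D(β) = ⌈Θ/a β⌉ ≥ 1` into decay with ratio `q = 1 − 1/K ∈ [0, 1)`; S3 turns decay into clustering at rate `κ(q) n / D`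
with per-pair constants; `a β ≤ Θ` eventually (the load-bearing clause `a → 0` of the package, Disproof §4) gives
`D(β) · a(β) ≤ 2Θ`, hence rate `(κ/(2Θ)) · a(β) · n`; domination `a ≤ K₀ a'` costs the factor `K₀` in the rate
(`KnabeBlockSampler.reduction_concl_of_dominated`, landed with the sibling line's reduction p92432 and reused here).
-/

open scoped BigOperators
open MeasureTheory Filter Topology
open Literature.MathematicalPhysics.QuantumFieldTheory Literature.MathematicalPhysics.QuantumLattice
open Summit.QuantumFields.YangMills.Theses.LangevinControlUV

noncomputable section

namespace Summit.QuantumFields.YangMills.Theorems.LatticeGapInUVUnits.FemtoSlabNondegeneracy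

section Pipeline

variable {G : Type} [Group G] [TopologicalSpace G] [IsTopologicalGroup G] [CompactSpace G]
  [MeasurableSpace G] [BorelSpace G]

/-- **The pipeline (slab certificate) + S2 + S3 ⇒ clustering in the units of `a`** (the line's constant-slack
bookkeeping): with `q = 1 − 1/K ∈ [0, 1)`, S3 (`stub_decayToClustering`, landed) yields a rate `κ > 0` and per-pair
constants; S2 (`stub_slabToDecay`, landed) turns the slab inequality on `(2S+1)⁴` at margin `D(β) = ⌈Θ/a β⌉ ≥ 1` into
decay of conditional expectations; and `a β ≤ Θ` eventually (THIS is where `Tendsto a atTop (𝓝 0)` is load-bearing,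
Disproof §4) gives `D(β) · a(β) ≤ 2Θ`, hence `κ n / D ≥ (κ/(2Θ)) a(β) n`: clustering with `c₁ = κ/(2Θ)`, the
certificate's `S₁`, `β₂' = max β₂ β_Θ` and `C(A, B) = max C 0`. -/
theorem reduction_concl_of_slab (r : LatticeRep G) {a : ℝ → ℝ} (hpos : ∀ β, 0 < a β)
    (hlim : Tendsto a atTop (𝓝 0)) {Θ K β₂ : ℝ} {S₁ : ℝ → ℕ} (hΘ : 0 < Θ) (hK : 1 ≤ K)
    (hslab : ∀ β : ℝ, β₂ ≤ β → ∀ S : ℕ, S₁ β ≤ S → ∀ (t₀ : ZMod (2 * S + 1)) (w : ℕ), w + 2 * ⌈Θ / a β⌉₊ ≤ 2 * S → ∀ F : GaugeConfig 4 (2 * S + 1) G → ℝ, Measurable F → (∃ M : ℝ, ∀ U, |F U| ≤ M) → DependsOn F {ℓ : Edge 4 (2 * S + 1) | (ℓ.1 0 - t₀).val < w} → ∫ U, (F U - ∫ V, F V ∂(wilsonMeasure (d := 4) (L := 2 * S + 1) r.ρ β)) ^ 2 ∂(wilsonMeasure (d := 4) (L := 2 * S + 1) r.ρ β) ≤ K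 * ∫ U, (F U - ((wilsonMeasure (d := 4) (L := 2 * S + 1) r.ρ β)[F|cylinderEvents (X := fun _ : Edge 4 (2 * S + 1) => G) {ℓ : Edge 4 (2 * S + 1) | (ℓ.1 0 - (t₀ - ((⌈Θ / a β⌉₊ - 1 : ℕ) : ZMod (2 * S + 1)))).val < w + 2 * (⌈Θ / a β⌉₊ - 1)}ᶜ]) U) ^ 2 ∂(wilsonMeasure (d := 4) (L := 2 * S + 1) r.ρ β)) :
    ∃ (c₁ β₂ : ℝ) (S₁ : ℝ → ℕ), 0 < c₁ ∧ ∀ A B : YMSpecies G, ∃ C : ℝ, ∀ β : ℝ, β₂ ≤ β → ∀ S n : ℕ, S₁ β ≤ S → n ≤ S → |latticeConnectedCorr r.ρ β (2 * S + 1) A.F B.F n| ≤ C * Real.exp (-(c₁ * a β * n)) := by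
  -- the contraction ratio `q = 1 − 1/K ∈ [0, 1)`
  have hK0 : 0 < K := lt_of_lt_of_le one_pos hK
  have hq0 : 0 ≤ 1 - 1 / K := by
    have : 1 / K ≤ 1 := by rw [div_le_one hK0]; exact hK
    linarith
  have hq1 : 1 - 1 / K < 1 := by
    have : 0 < 1 / K := by positivity
    linarith
  obtain ⟨κ, hκ, hAB⟩ := stub_decayToClustering G r (1 - 1 / K) hq0 hq1
  -- `a β < Θ` eventually (Disproof §4: `Tendsto a` is load-bearing exactly here)
  obtain ⟨β₃, hβ₃⟩ := eventually_atTop.1 (hlim (Iio_mem_nhds hΘ))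
  refine ⟨κ / (2 * Θ), max β₂ β₃, S₁, by positivity, fun A B => ?_⟩
  obtain ⟨C, hC⟩ := hAB A B
  refine ⟨max C 0, fun β hβ S n hS hn => ?_⟩
  have hβ2 : β₂ ≤ β := (le_max_left _ _).trans hβ
  have haΘ : a β < Θ := hβ₃ β ((le_max_right _ _).trans hβ)
  have hΘa : 0 < Θ / a β := div_pos hΘ (hpos β)
  have hD1 : 1 ≤ ⌈Θ / a β⌉₊ := Nat.one_le_iff_ne_zero.2 (Nat.ceil_pos.2 hΘa).ne'
  have hdec := stub_slabToDecay G r β S ⌈Θ / a β⌉₊ K _ rfl hD1 hK (hslab β hβ2 S hS)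
  refine (hC β S ⌈Θ / a β⌉₊ n _ rfl hD1 hn hdec).trans ?_
  -- compare the exponents: `κ/(2Θ) · a β · n ≤ κ / ⌈Θ/a β⌉ · n` because `⌈Θ/a β⌉ · a β ≤ 2Θ`
  have hDR : ((⌈Θ / a β⌉₊ : ℕ) : ℝ) < Θ / a β + 1 := Nat.ceil_lt_add_one hΘa.le
  have hDa : ((⌈Θ / a β⌉₊ : ℕ) : ℝ) * a β ≤ 2 * Θ := by
    have h1 : ((⌈Θ / a β⌉₊ : ℕ) : ℝ) * a β < (Θ / a β + 1) * a β := mul_lt_mul_of_pos_right hDR (hpos β)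
    have h2 : (Θ / a β + 1) * a β = Θ + a β := by
      rw [add_mul, one_mul, div_mul_cancel₀ Θ (hpos β).ne']
    linarith
  have hDpos : (0 : ℝ) < ((⌈Θ / a β⌉₊ : ℕ) : ℝ) := by exact_mod_cast hD1
  have hn0 : (0 : ℝ) ≤ n := Nat.cast_nonneg n
  have key : κ / (2 * Θ) * a β * n ≤ κ / (⌈Θ / a β⌉₊ : ℕ) * n := by
    refine mul_le_mul_of_nonneg_right ?_ hn0
    rw [div_mul_eq_mul_div, div_le_div_iff₀ (by positivity) hDpos]
    calc κ * a β * ((⌈Θ / a β⌉₊ : ℕ) : ℝ) = κ * (((⌈Θ / a β⌉₊ : ℕ) : ℝ) * a β) := by ring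
      _ ≤ κ * (2 * Θ) := mul_le_mul_of_nonneg_left hDa hκ.le
  calc C * Real.exp (-(κ / (⌈Θ / a β⌉₊ : ℕ) * n)) ≤ max C 0 * Real.exp (-(κ / (⌈Θ / a β⌉₊ : ℕ) * n)) :=
        mul_le_mul_of_nonneg_right (le_max_left _ _) (Real.exp_pos _).le
    _ ≤ max C 0 * Real.exp (-(κ / (2 * Θ) * a β * n)) :=
        mul_le_mul_of_nonneg_left (Real.exp_le_exp.2 (neg_le_neg key)) (le_max_right _ _)

end Pipeline

/-- **The repaired crux C′ from the femto-slab certificate alone** (line `femto-slab-nondegeneracy`, S1 ⇒ C′): for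
every compact simple `G`, faithful `r` and CONTINUOUS unit map `a` carrying the femto two-point package, a two-sided
slab non-degeneracy inequality on the tori `(2S+1)⁴`, `S ≥ S₁ β`, at the femto margin `⌈Θ/a β⌉` with a constant `K`
uniform in `β`, volume and slab yields volume-uniform exponential clustering of all pairs of gauge-invariant local
observables at rate `c₁ · a(β)` per lattice step — verbatim the standing disprover's `CruxRepaired` (the crux
restricted to continuous unit maps), with both sides written out. -/
theorem cruxRepaired_of_femtoSlab :
    (∀ (G : Type) [Group G] [TopologicalSpace G] [IsTopologicalGroup G] [CompactSpace G], IsCompactSimpleLieGroup G → letI : MeasurableSpace G := borel G; haveI : BorelSpace G := ⟨rfl⟩; ∀ (r : LatticeRep G) (a : ℝ → ℝ), Continuous a → (∃ (Γ : ℝ → ℝ) (β₀ ℓ₀ c C : ℝ), 0 < ℓ₀ ∧ 0 < c ∧ (∀ β, 0 < a β) ∧ Tendsto a atTop (nhds 0) ∧ (∀ s : ℝ, 0 < s → s ≤ ℓ₀ → 0 < Γ s ∧ Γ s ≤ 1) ∧ ∀ (L : ℕ) [NeZero L] (β : ℝ), β₀ ≤ β → (L : ℝ) * a β ≤ ℓ₀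 → let P : (Fin 4 → ZMod L) → Fin 4 → Fin 4 → GaugeConfig 4 L G → ℝ := fun x i j U => (r.N : ℝ) - (r.ρ (plaquetteHolonomy U x i j)).trace.re; let E : (GaugeConfig 4 L G → ℝ) → ℝ := fun F => wilsonExpectation (d := 4) (L := L) r.ρ β F; let cov : (GaugeConfig 4 L G → ℝ) → (GaugeConfig 4 L G → ℝ) → ℝ := fun F F' => E (fun U => F U * F' U) - E F * E F'; let dist : (Fin 4 → ZMod L) → (Fin 4 → ZMod L) → ℝ := fun x y => Real.sqrt (∑ k : Fin 4, (((x k - y k).valMinAbs : ℤ) : ℝ) ^ 2); (∀ n : ℕ, 1 ≤ n → 8 * n ≤ L → c * Γ ((n : ℝ) * a β) ≤ (n : ℝ) ^ 8 * cov (P 0 0 1) (P (Pi.single (2 : Fin 4) ((n : ℕ) : ZMod L)) 0 1) ∧ (n : ℝ) ^ 8 * cov (P 0 0 1) (P (Pi.single (2 : Fin 4) ((n : ℕ) : ZMod L)) 0 1) ≤ C * Γ ((n : ℝ) * a β)) ∧ (∀ (x y : Fin 4 → ZMod L) (i j i' j' : Fin 4), x ≠ y → i ≠ j → i' ≠ j'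 → |cov (P x i j) (P y i' j')| * dist x y ^ 8 ≤ C * Γ (dist x y * a β))) → ∃ (Θ K β₂ : ℝ) (S₁ : ℝ → ℕ), 0 < Θ ∧ 1 ≤ K ∧ ∀ β : ℝ, β₂ ≤ β → ∀ S : ℕ, S₁ β ≤ S → ∀ (t₀ : ZMod (2 * S + 1)) (w : ℕ), w + 2 * ⌈Θ / a β⌉₊ ≤ 2 * S → ∀ F : GaugeConfig 4 (2 * S + 1) G → ℝ, Measurable F → (∃ M : ℝ, ∀ U, |F U| ≤ M) → DependsOn F {ℓ : Edge 4 (2 * S + 1) | (ℓ.1 0 - t₀).val < w} → ∫ U, (F U - ∫ V, F V ∂(wilsonMeasure (d := 4) (L := 2 * S + 1) r.ρ β)) ^ 2 ∂(wilsonMeasure (d := 4) (L := 2 * S + 1) r.ρ β) ≤ K * ∫ U, (F U - ((wilsonMeasure (d := 4) (L := 2 * S + 1) r.ρ β)[F|cylinderEvents (X := fun _ : Edge 4 (2 * S + 1) => G) {ℓ : Edge 4 (2 * S + 1) | (ℓ.1 0 - (t₀ - ((⌈Θ / a β⌉₊ - 1 : ℕ) : ZMod (2 * S + 1)))).val < w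 + 2 * (⌈Θ / a β⌉₊ - 1)}ᶜ]) U) ^ 2 ∂(wilsonMeasure (d := 4) (L := 2 * S + 1) r.ρ β)) → ∀ (G : Type) [Group G] [TopologicalSpace G] [IsTopologicalGroup G] [CompactSpace G], IsCompactSimpleLieGroup G → letI : MeasurableSpace G := borel G; haveI : BorelSpace G := ⟨rfl⟩; ∀ (r : LatticeRep G) (a : ℝ → ℝ), Continuous a → (∃ (Γ : ℝ → ℝ) (β₀ ℓ₀ c C : ℝ), 0 < ℓ₀ ∧ 0 < c ∧ (∀ β, 0 < a β) ∧ Tendsto a atTop (nhds 0) ∧ (∀ s : ℝ, 0 < s → s ≤ ℓ₀ → 0 < Γ s ∧ Γ s ≤ 1) ∧ ∀ (L : ℕ) [NeZero L] (β : ℝ), β₀ ≤ β → (L : ℝ) * a β ≤ ℓ₀ → let P : (Fin 4 → ZMod L) → Fin 4 → Fin 4 → GaugeConfig 4 L G → ℝ := fun x i j U => (r.N : ℝ) - (r.ρ (plaquetteHolonomy U x i j)).trace.re; let E : (GaugeConfig 4 L G → ℝ) → ℝ := fun F => wilsonExpectation (d := 4) (L := L) r.ρ β F; let cov : (GaugeConfig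 4 L G → ℝ) → (GaugeConfig 4 L G → ℝ) → ℝ := fun F F' => E (fun U => F U * F' U) - E F * E F'; let dist : (Fin 4 → ZMod L) → (Fin 4 → ZMod L) → ℝ := fun x y => Real.sqrt (∑ k : Fin 4, (((x k - y k).valMinAbs : ℤ) : ℝ) ^ 2); (∀ n : ℕ, 1 ≤ n → 8 * n ≤ L → c * Γ ((n : ℝ) * a β) ≤ (n : ℝ) ^ 8 * cov (P 0 0 1) (P (Pi.single (2 : Fin 4) ((n : ℕ) : ZMod L)) 0 1) ∧ (n : ℝ) ^ 8 * cov (P 0 0 1) (P (Pi.single (2 : Fin 4) ((n : ℕ) : ZMod L)) 0 1) ≤ C * Γ ((n : ℝ) * a β)) ∧ (∀ (x y : Fin 4 → ZMod L) (i j i' j' : Fin 4), x ≠ y → i ≠ j → i' ≠ j' → |cov (P x i j) (P y i' j')| * dist x y ^ 8 ≤ C * Γ (dist x y * a β))) → ∃ (c₁ β₂ : ℝ) (S₁ : ℝ → ℕ), 0 < c₁ ∧ ∀ A B : YMSpecies G, ∃ C : ℝ, ∀ β : ℝ, β₂ ≤ β → ∀ S n : ℕ, S₁ β ≤ S → n ≤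 S → |latticeConnectedCorr r.ρ β (2 * S + 1) A.F B.F n| ≤ C * Real.exp (-(c₁ * a β * n)) := by
  intro h1 G _ _ _ _ hG
  letI : MeasurableSpace G := borel G
  haveI : BorelSpace G := ⟨rfl⟩
  intro r a ha hP
  obtain ⟨Θ, K, β₂, S₁, hΘ, hK, hslab⟩ := h1 G hG r a ha hP
  obtain ⟨Γ, β₀, ℓ₀, c, C, -, -, hpos, hlim, -, -⟩ := hP
  exact reduction_concl_of_slab r hpos hlim hΘ hK hslab

/-- **The crux BY NAME from the socket and the repaired crux** (line-independent bookkeeping: S0 ruler reduction +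
C′ ⇒ the typed crux): S0 hands, for every unit map `a` with the package, a continuous dominating unit map `a'` with the
package; C′ clusters in the units of `a'`; domination returns to the units of `a` (the sibling line's landed `KnabeBlockSampler.reduction_concl_of_dominated`, reused).
With `cruxRepaired_of_femtoSlab` this is the line's composition S0 + S1 (+ landed S2, S3) ⇒ `LatticeGapInUVUnits`. -/
theorem latticeGapInUVUnits_of_rulerReduction_of_cruxRepaired :
    (∀ (G : Type) [Group G] [TopologicalSpace G] [IsTopologicalGroup G] [CompactSpace G], IsCompactSimpleLieGroup G → letI : MeasurableSpace G := borel G; haveI : BorelSpace G := ⟨rfl⟩; ∀ (r : LatticeRep G) (a : ℝ → ℝ), (∃ (Γ : ℝ → ℝ) (β₀ ℓ₀ c C : ℝ), 0 < ℓ₀ ∧ 0 < c ∧ (∀ β, 0 < a β) ∧ Tendsto a atTop (nhds 0) ∧ (∀ s : ℝ, 0 < s → s ≤ ℓ₀ → 0 < Γ s ∧ Γ s ≤ 1) ∧ ∀ (L : ℕ) [NeZero L] (β : ℝ), β₀ ≤ β → (L : ℝ) * a β ≤ ℓ₀ → let P : (Fin 4 → ZMod L) → Fin 4 → Fin 4 →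 GaugeConfig 4 L G → ℝ := fun x i j U => (r.N : ℝ) - (r.ρ (plaquetteHolonomy U x i j)).trace.re; let E : (GaugeConfig 4 L G → ℝ) → ℝ := fun F => wilsonExpectation (d := 4) (L := L) r.ρ β F; let cov : (GaugeConfig 4 L G → ℝ) → (GaugeConfig 4 L G → ℝ) → ℝ := fun F F' => E (fun U => F U * F' U) - E F * E F'; let dist : (Fin 4 → ZMod L) → (Fin 4 → ZMod L) → ℝ := fun x y => Real.sqrt (∑ k : Fin 4, (((x k - y k).valMinAbs : ℤ) : ℝ) ^ 2); (∀ n : ℕ, 1 ≤ n → 8 * n ≤ L → c * Γ ((n : ℝ) * a β) ≤ (n : ℝ) ^ 8 * cov (P 0 0 1) (P (Pi.single (2 : Fin 4) ((n : ℕ) : ZMod L)) 0 1) ∧ (n : ℝ) ^ 8 * cov (P 0 0 1) (P (Pi.single (2 : Fin 4) ((n : ℕ) : ZMod L)) 0 1) ≤ C * Γ ((n : ℝ) * a β)) ∧ (∀ (x y : Fin 4 → ZMod L) (i j i' j' : Fin 4), x ≠ y → i ≠ j → i' ≠ j' → |cov (P x i j) (P y i' j')| * dist x y ^ 8 ≤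 C * Γ (dist x y * a β))) → ∃ (a' : ℝ → ℝ) (K₀ : ℝ), Continuous a' ∧ (∃ (Γ : ℝ → ℝ) (β₀ ℓ₀ c C : ℝ), 0 < ℓ₀ ∧ 0 < c ∧ (∀ β, 0 < a' β) ∧ Tendsto a' atTop (nhds 0) ∧ (∀ s : ℝ, 0 < s → s ≤ ℓ₀ → 0 < Γ s ∧ Γ s ≤ 1) ∧ ∀ (L : ℕ) [NeZero L] (β : ℝ), β₀ ≤ β → (L : ℝ) * a' β ≤ ℓ₀ → let P : (Fin 4 → ZMod L) → Fin 4 → Fin 4 → GaugeConfig 4 L G → ℝ := fun x i j U => (r.N : ℝ) - (r.ρ (plaquetteHolonomy U x i j)).trace.re; let E : (GaugeConfig 4 L G → ℝ) → ℝ := fun F => wilsonExpectation (d := 4) (L := L) r.ρ β F; let cov : (GaugeConfig 4 L G → ℝ) → (GaugeConfig 4 L G → ℝ) → ℝ := fun F F' => E (fun U => F U * F' U) - E F * E F'; let dist : (Fin 4 → ZMod L) → (Fin 4 → ZMod L) → ℝ := fun x y => Real.sqrt (∑ k : Fin 4, (((x k - y k).valMinAbs : ℤ) : ℝ) ^ 2);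 (∀ n : ℕ, 1 ≤ n → 8 * n ≤ L → c * Γ ((n : ℝ) * a' β) ≤ (n : ℝ) ^ 8 * cov (P 0 0 1) (P (Pi.single (2 : Fin 4) ((n : ℕ) : ZMod L)) 0 1) ∧ (n : ℝ) ^ 8 * cov (P 0 0 1) (P (Pi.single (2 : Fin 4) ((n : ℕ) : ZMod L)) 0 1) ≤ C * Γ ((n : ℝ) * a' β)) ∧ (∀ (x y : Fin 4 → ZMod L) (i j i' j' : Fin 4), x ≠ y → i ≠ j → i' ≠ j' → |cov (P x i j) (P y i' j')| * dist x y ^ 8 ≤ C * Γ (dist x y * a' β))) ∧ 0 < K₀ ∧ ∀ᶠ β in atTop, a β ≤ K₀ * a' β) → (∀ (G : Type) [Group G] [TopologicalSpace G] [IsTopologicalGroup G] [CompactSpace G], IsCompactSimpleLieGroup G → letI : MeasurableSpace G := borel G; haveI : BorelSpace G := ⟨rfl⟩; ∀ (r : LatticeRep G) (a : ℝ → ℝ), Continuous a → (∃ (Γ : ℝ → ℝ) (β₀ ℓ₀ c C : ℝ), 0 < ℓ₀ ∧ 0 < c ∧ (∀ β, 0 < a β) ∧ Tendsto a atTop (nhds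 0) ∧ (∀ s : ℝ, 0 < s → s ≤ ℓ₀ → 0 < Γ s ∧ Γ s ≤ 1) ∧ ∀ (L : ℕ) [NeZero L] (β : ℝ), β₀ ≤ β → (L : ℝ) * a β ≤ ℓ₀ → let P : (Fin 4 → ZMod L) → Fin 4 → Fin 4 → GaugeConfig 4 L G → ℝ := fun x i j U => (r.N : ℝ) - (r.ρ (plaquetteHolonomy U x i j)).trace.re; let E : (GaugeConfig 4 L G → ℝ) → ℝ := fun F => wilsonExpectation (d := 4) (L := L) r.ρ β F; let cov : (GaugeConfig 4 L G → ℝ) → (GaugeConfig 4 L G → ℝ) → ℝ := fun F F' => E (fun U => F U * F' U) - E F * E F'; let dist : (Fin 4 → ZMod L) → (Fin 4 → ZMod L) → ℝ := fun x y => Real.sqrt (∑ k : Fin 4, (((x k - y k).valMinAbs : ℤ) : ℝ) ^ 2); (∀ n : ℕ, 1 ≤ n → 8 * n ≤ L → c * Γ ((n : ℝ) * a β) ≤ (n : ℝ) ^ 8 * cov (P 0 0 1) (P (Pi.single (2 : Fin 4) ((n : ℕ) : ZMod L)) 0 1) ∧ (n : ℝ) ^ 8 * cov (P 0 0 1) (P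 (Pi.single (2 : Fin 4) ((n : ℕ) : ZMod L)) 0 1) ≤ C * Γ ((n : ℝ) * a β)) ∧ (∀ (x y : Fin 4 → ZMod L) (i j i' j' : Fin 4), x ≠ y → i ≠ j → i' ≠ j' → |cov (P x i j) (P y i' j')| * dist x y ^ 8 ≤ C * Γ (dist x y * a β))) → ∃ (c₁ β₂ : ℝ) (S₁ : ℝ → ℕ), 0 < c₁ ∧ ∀ A B : YMSpecies G, ∃ C : ℝ, ∀ β : ℝ, β₂ ≤ β → ∀ S n : ℕ, S₁ β ≤ S → n ≤ S → |latticeConnectedCorr r.ρ β (2 * S + 1) A.F B.F n| ≤ C * Real.exp (-(c₁ * a β * n))) → LatticeGapInUVUnits := by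
  intro h0 hC G _ _ _ _ hG
  letI : MeasurableSpace G := borel G
  haveI : BorelSpace G := ⟨rfl⟩
  intro r a hP
  obtain ⟨a', K₀, ha', hP', hK₀, hdom⟩ := h0 G hG r a hP
  exact KnabeBlockSampler.reduction_concl_of_dominated r (hC G hG r a' ha' hP') hK₀ hdom

/-- **The line's composition**: S0 (ruler reduction) + S1 (femto-slab certificate) ⇒ the crux BY NAME, through the
landed S2/S3 (`cruxRepaired_of_femtoSlab`) and the socket bookkeeping (`latticeGapInUVUnits_of_rulerReduction_of_cruxRepaired`). -/
theorem latticeGapInUVUnits_of_rulerReduction_of_femtoSlab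
    (h0 : ∀ (G : Type) [Group G] [TopologicalSpace G] [IsTopologicalGroup G] [CompactSpace G], IsCompactSimpleLieGroup G → letI : MeasurableSpace G := borel G; haveI : BorelSpace G := ⟨rfl⟩; ∀ (r : LatticeRep G) (a : ℝ → ℝ), (∃ (Γ : ℝ → ℝ) (β₀ ℓ₀ c C : ℝ), 0 < ℓ₀ ∧ 0 < c ∧ (∀ β, 0 < a β) ∧ Tendsto a atTop (nhds 0) ∧ (∀ s : ℝ, 0 < s → s ≤ ℓ₀ → 0 < Γ s ∧ Γ s ≤ 1) ∧ ∀ (L : ℕ) [NeZero L] (β : ℝ), β₀ ≤ β → (L : ℝ) * a β ≤ ℓ₀ → let P : (Fin 4 → ZMod L) → Fin 4 → Fin 4 → GaugeConfig 4 L G → ℝ := fun x i j U => (r.N : ℝ) - (r.ρ (plaquetteHolonomy U x i j)).trace.re; let E : (GaugeConfig 4 L G → ℝ) → ℝ := fun F => wilsonExpectation (d := 4) (L := L) r.ρ β F; let cov : (GaugeConfig 4 L G → ℝ) → (GaugeConfig 4 L G → ℝ) → ℝ := fun F F' => E (fun U => F U * F' U) - E F * E F'; let dist : (Fin 4 → ZMod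 L) → (Fin 4 → ZMod L) → ℝ := fun x y => Real.sqrt (∑ k : Fin 4, (((x k - y k).valMinAbs : ℤ) : ℝ) ^ 2); (∀ n : ℕ, 1 ≤ n → 8 * n ≤ L → c * Γ ((n : ℝ) * a β) ≤ (n : ℝ) ^ 8 * cov (P 0 0 1) (P (Pi.single (2 : Fin 4) ((n : ℕ) : ZMod L)) 0 1) ∧ (n : ℝ) ^ 8 * cov (P 0 0 1) (P (Pi.single (2 : Fin 4) ((n : ℕ) : ZMod L)) 0 1) ≤ C * Γ ((n : ℝ) * a β)) ∧ (∀ (x y : Fin 4 → ZMod L) (i j i' j' : Fin 4), x ≠ y → i ≠ j → i' ≠ j' → |cov (P x i j) (P y i' j')| * dist x y ^ 8 ≤ C * Γ (dist x y * a β))) → ∃ (a' : ℝ → ℝ) (K₀ : ℝ), Continuous a' ∧ (∃ (Γ : ℝ → ℝ) (β₀ ℓ₀ c C : ℝ), 0 < ℓ₀ ∧ 0 < c ∧ (∀ β, 0 < a' β) ∧ Tendsto a' atTop (nhds 0) ∧ (∀ s : ℝ, 0 < s → s ≤ ℓ₀ → 0 < Γ s ∧ Γ s ≤ 1) ∧ ∀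 (L : ℕ) [NeZero L] (β : ℝ), β₀ ≤ β → (L : ℝ) * a' β ≤ ℓ₀ → let P : (Fin 4 → ZMod L) → Fin 4 → Fin 4 → GaugeConfig 4 L G → ℝ := fun x i j U => (r.N : ℝ) - (r.ρ (plaquetteHolonomy U x i j)).trace.re; let E : (GaugeConfig 4 L G → ℝ) → ℝ := fun F => wilsonExpectation (d := 4) (L := L) r.ρ β F; let cov : (GaugeConfig 4 L G → ℝ) → (GaugeConfig 4 L G → ℝ) → ℝ := fun F F' => E (fun U => F U * F' U) - E F * E F'; let dist : (Fin 4 → ZMod L) → (Fin 4 → ZMod L) → ℝ := fun x y => Real.sqrt (∑ k : Fin 4, (((x k - y k).valMinAbs : ℤ) : ℝ) ^ 2); (∀ n : ℕ, 1 ≤ n → 8 * n ≤ L → c * Γ ((n : ℝ) * a' β) ≤ (n : ℝ) ^ 8 * cov (P 0 0 1) (P (Pi.single (2 : Fin 4) ((n : ℕ) : ZMod L)) 0 1) ∧ (n : ℝ) ^ 8 * cov (P 0 0 1) (P (Pi.single (2 : Fin 4) ((n : ℕ) : ZMod L)) 0 1) ≤ C * Γ ((n : ℝ) * a' β)) ∧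 (∀ (x y : Fin 4 → ZMod L) (i j i' j' : Fin 4), x ≠ y → i ≠ j → i' ≠ j' → |cov (P x i j) (P y i' j')| * dist x y ^ 8 ≤ C * Γ (dist x y * a' β))) ∧ 0 < K₀ ∧ ∀ᶠ β in atTop, a β ≤ K₀ * a' β)
    (h1 : ∀ (G : Type) [Group G] [TopologicalSpace G] [IsTopologicalGroup G] [CompactSpace G], IsCompactSimpleLieGroup G → letI : MeasurableSpace G := borel G; haveI : BorelSpace G := ⟨rfl⟩; ∀ (r : LatticeRep G) (a : ℝ → ℝ), Continuous a → (∃ (Γ : ℝ → ℝ) (β₀ ℓ₀ c C : ℝ), 0 < ℓ₀ ∧ 0 < c ∧ (∀ β, 0 < a β) ∧ Tendsto a atTop (nhds 0) ∧ (∀ s : ℝ, 0 < s → s ≤ ℓ₀ → 0 < Γ s ∧ Γ s ≤ 1) ∧ ∀ (L : ℕ) [NeZero L] (β : ℝ), β₀ ≤ β → (L : ℝ) * a β ≤ ℓ₀ → let P : (Fin 4 → ZMod L) → Fin 4 → Fin 4 → GaugeConfig 4 L G → ℝ := fun x i j U => (r.N : ℝ) - (r.ρ (plaquetteHolonomy U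 x i j)).trace.re; let E : (GaugeConfig 4 L G → ℝ) → ℝ := fun F => wilsonExpectation (d := 4) (L := L) r.ρ β F; let cov : (GaugeConfig 4 L G → ℝ) → (GaugeConfig 4 L G → ℝ) → ℝ := fun F F' => E (fun U => F U * F' U) - E F * E F'; let dist : (Fin 4 → ZMod L) → (Fin 4 → ZMod L) → ℝ := fun x y => Real.sqrt (∑ k : Fin 4, (((x k - y k).valMinAbs : ℤ) : ℝ) ^ 2); (∀ n : ℕ, 1 ≤ n → 8 * n ≤ L → c * Γ ((n : ℝ) * a β) ≤ (n : ℝ) ^ 8 * cov (P 0 0 1) (P (Pi.single (2 : Fin 4) ((n : ℕ) : ZMod L)) 0 1) ∧ (n : ℝ) ^ 8 * cov (P 0 0 1) (P (Pi.single (2 : Fin 4) ((n : ℕ) : ZMod L)) 0 1) ≤ C * Γ ((n : ℝ) * a β)) ∧ (∀ (x y : Fin 4 → ZMod L) (i j i' j' : Fin 4), x ≠ y → i ≠ j → i' ≠ j' → |cov (P x i j) (P y i' j')| * dist x y ^ 8 ≤ C * Γ (dist x y * a β))) → ∃ (Θ K β₂ : ℝ) (S₁ : ℝ → ℕ), 0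 < Θ ∧ 1 ≤ K ∧ ∀ β : ℝ, β₂ ≤ β → ∀ S : ℕ, S₁ β ≤ S → ∀ (t₀ : ZMod (2 * S + 1)) (w : ℕ), w + 2 * ⌈Θ / a β⌉₊ ≤ 2 * S → ∀ F : GaugeConfig 4 (2 * S + 1) G → ℝ, Measurable F → (∃ M : ℝ, ∀ U, |F U| ≤ M) → DependsOn F {ℓ : Edge 4 (2 * S + 1) | (ℓ.1 0 - t₀).val < w} → ∫ U, (F U - ∫ V, F V ∂(wilsonMeasure (d := 4) (L := 2 * S + 1) r.ρ β)) ^ 2 ∂(wilsonMeasure (d := 4) (L := 2 * S + 1) r.ρ β) ≤ K * ∫ U, (F U - ((wilsonMeasure (d := 4) (L := 2 * S + 1) r.ρ β)[F|cylinderEvents (X := fun _ : Edge 4 (2 * S + 1) => G) {ℓ : Edge 4 (2 * S + 1) | (ℓ.1 0 - (t₀ - ((⌈Θ / a β⌉₊ - 1 : ℕ) : ZMod (2 * S + 1)))).val < w + 2 * (⌈Θ / a β⌉₊ - 1)}ᶜ]) U) ^ 2 ∂(wilsonMeasure (d := 4) (L := 2 * S + 1) r.ρ β)) :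
    LatticeGapInUVUnits :=
  latticeGapInUVUnits_of_rulerReduction_of_cruxRepaired h0 (cruxRepaired_of_femtoSlab h1)

end Summit.QuantumFields.YangMills.Theorems.LatticeGapInUVUnits.FemtoSlabNondegeneracy

end
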